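import Summits.QuantumFields.YangMills.Theorems.BalabanUVNodesN18KingModelVertices

/-!
# BalabanUVNodes ∕ N18 — THE U3 RUNG WITH LIVE BRACKETS: in King's model with Lipschitz vertex functions node U3's shared
# bundle carries `N18At`, `N22At` WITH NON-ZERO HISTORY MODULI AND FADING MEMORY, the background-Lipschitz bracket with a
# NON-ZERO modulus of polynomial (constant) growth, and node U3's composed target with ALL THREE BRACKETS LIVE (Track A, DAG
# node N18 = NE5 `T4OutputRate.NE5 EA EB W κ θ C₅` :211; director-ym R134 row n18 s3 «King-model transfer `N18KingModelTorus`
# (κ, C₅ from (d, L, a, m², γ)) → `TwoRunTorusNE5Final*`», module 8 of seat pub-ymgap-dag-n18-e; the live-bracket twin of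
# p450669 `N18KingModelU3Rung.u3Rung_kingModel_threeFactor_torus`, whose Lipschitz ∕ history letters were ZERO)

HONEST FRAMING.  Count-neutral kernel bookkeeping (seat pub-ymgap-dag-n18-e g5, strategy s3; `--supports` K3′
`SpineGivenEndpointR12`, helper).  One application of module 6b (`N18KingModelVertices.kingModel_vertex_allShapes_torus`) and of
the cell's U3 bookkeeping `T4OutputRate.u3_threeBrackets`; King's `A = 0` operators decorated with abstract bounded ∕ Lipschitz
vertex insertions — NOT King's `C(A)`, NOT Bałaban's covariant one-step outputs `E^{(j)}(X; g, U_k(V))` of [Balaban1987RG1]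
(0.24)∕(2.13), for which NE5 ∕ NE9 are NOT IN PRINT and have no tree producer (NODE O instance 0∕1); N17 ∕ (D4) NOT modelled
(run B's family is constant in its first coupling); NOT a node discharge; finite tori; nothing continuum ∕ ℝ⁴ ∕ OS ∕ mass-gap ∕
Clay.  THEOREMS ONLY: 0 `def`, 0 `sorry`, standard axioms.

THE POINT.  p450669 (module 1 of this seat) placed King's (4.42) graphs on node U3's SHARED BUNDLE `U3Carriers` — `N18At`,
`N22At`, bracket (T), `PolyLipGrowth`, U3's composed target — with the history moduli, the fading constant and the
background-Lipschitz modulus all ZERO (`u3Target_of_unread`: target `(0 + 0 + C₅)·θ^j`), and typed «what V-dependence adds» as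
the non-vanishing of exactly those letters.  Module 6b made them non-zero for vertex-decorated graphs.  THIS FILE,
**`u3Rung_kingModel_vertex_torus`**, is the live-bracket rung: for King's ACTUAL graphs with vertex functions `h, k` bounded by
one, `ℓ`-Lipschitz in the carriers' gauge and `Λ`-Lipschitz in the coupling history with `FadingMemory C₉ ω Λ`, the bundle
`u = ⟨C, W, γ′, κ, EA, fun _ => EB, L^{−γ∕2}, C₅, 2Λ·A, 2C₉·A, ω, cr, ρ⟩` carries (i) `N18At u`; (ii) `N22At u` = `NE9 EA W κ (2Λ·A) ∧
FadingMemory (2C₉·A) ω (2Λ·A)`; (iii) `LipBackground EA W κ (fun _ _ => 2ℓ·A)`; (iv) `PolyLipGrowth (fun _ _ => 2ℓ·A) gT (2ℓ·A) q` for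
every table and degree (a scale-free modulus grows polynomially with degree 0); (v) node U3's composed target at ANY two
couplings of the window and ANY backgrounds `δ`-close through the transport:
`|E_A(g^A, U^A, X) − E_B(g^B, U^B, X)| ≤ (2ℓA·δ + Σ_{i<j} 2Λ_{j,i}A·|g^A_i − g^B_i| + C₅θ^j)·e^{−κ d X}` — `u3_threeBrackets` with no
bracket idle (p450669's target is the case `ℓ = 0`, `Λ = 0`).  §2 **`n18At_dressed_kingModel_vertex_torus`** — the DRESSED bundle of
record (`U3Carriers` docstring: domains `Dom ⊕ Dom × T`, dressed pieces read at the same letters «UNIFORM in `t` on the source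
window — a prover's burden inside N18»): with a `t`-indexed family of vertex functions for the dressed pieces, `N18At` on the
dressed bundle holds by `N18AtByName.n18At_dressed_iff` — uniformity in `t` is AUTOMATIC here because 6b's letters depend on
`(d, L, a, m², γ)` only, not on the insertion.
WHAT THIS DOES NOT DO.  The vertex moduli `ℓ, Λ, C₉, ω` are DATA; nothing says Bałaban's letters have these values; N17∕(D4)
not modelled; `A = 0` operators; NOT Bałaban's `E^{(j)}(X; g, U)`.

Sources: C. King, Commun. Math. Phys. **102** (1986) 649–677 [King1986] — Prop. 3.9 (3.73) p. 665, (4.42)–(4.43) p. 675; T. Bałaban,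
Commun. Math. Phys. **109** (1987) 249–301 [Balaban1987RG1] — (0.24)–(0.25) p. 257, (1.18) p. 263, §1 p. 263, §5 p. 298; **119**
(1988) 243–285 [Balaban1988Convergent] (2.27)(ii)–(2.28) p. 259.  No claim about the mass gap.
-/

noncomputable section

namespace Summit.QuantumFields.YangMills.BalabanUVNodes.N18KingModelVertexU3

open Real Matrix
open Literature.MathematicalPhysics.QuantumFieldTheory.Balaban1983to89
open Literature.MathematicalPhysics.QuantumFieldTheory.Balaban1983to89.T4OutputRate
  (Carriers Functional NE5 DecayBound NE9 LipBackground FadingMemory u3_threeBrackets)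
open Literature.MathematicalPhysics.QuantumFieldTheory.Balaban1983to89.T4TowerRateComposition (PolyLipGrowth)
open Literature.MathematicalPhysics.QuantumFieldTheory.Balaban1983to89.B5Prop11Plancherel (Tor fine)
open Literature.MathematicalPhysics.QuantumFieldTheory.King1986 (aK)
open Literature.MathematicalPhysics.QuantumFieldTheory.King1986.Torus (minimiser effLaplacian blockProj blockOf tdistT)
open Summit.QuantumFields.YangMills.BalabanUVNodes.N18KingModel (kingTheta_pos)
open Summit.QuantumFields.YangMills.BalabanUVNodes.N18AtByName (n18At_of_ne5 n18At_dressed_iff)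
open Summit.QuantumFields.YangMills.BalabanUVNodes.N18KingModelVertices (kingModel_vertex_allShapes_torus)
open YMDAG.UVSplit (U3Carriers N18At N22At)

variable {d : ℕ}

/-- **THE KING-MODEL U3 RUNG WITH LIVE BRACKETS.**  For `d ≥ 1`, odd `L > 1`, `a > 0`, `m² > 0`, `0 ≤ γ ≤ 1` there are `κ > 0`,
`A ≥ 0`, `C₅ ≥ 0` (functions of `d, L, a, m², γ` only) such that on 6b's binder list (volumes, carriers, readings, vertex functions
`h, k` bounded by one, King's two vertex-decorated three-factor read-outs, window) and for vertex moduli `ℓ ≥ 0` (gauge-Lipschitz),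
`Λ ≥ 0` with `FadingMemory C₉ ω Λ` (history-Lipschitz), radius `γ′`, read-out letters `cr, ρ`: the bundle
`⟨C, W, γ′, κ, EA, fun _ => EB, L^{−γ∕2}, C₅, 2Λ·A, 2C₉·A, ω, cr, ρ⟩` carries `N18At` and `N22At`, `LipBackground EA W κ (2ℓ·A)`,
`PolyLipGrowth (2ℓ·A) gT (2ℓ·A) q`, and node U3's composed target `(2ℓA·δ + Σ_{i<j} 2Λ_{j,i}A|g^A_i − g^B_i| + C₅θ^j)·e^{−κ d X}` at
any `g^A, g^B ∈ W` and backgrounds with `gauge(U^A, T U^B) ≤ δ` (`u3_threeBrackets`, all three brackets live).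
[cite: King1986, Prop. 3.9 (3.73) p.665, (4.42)–(4.43) p.675; Balaban1987RG1, (0.25) p.257, (1.18) p.263, §5 p.298; Balaban1988Convergent, (2.27) p.259] -/
theorem u3Rung_kingModel_vertex_torus (hd : 1 ≤ d) (L : ℕ) [NeZero L] (hLp : Odd L ∧ 1 < L) {a m2 : ℝ}
    (ha : 0 < a) (hm : 0 < m2) {γ : ℝ} (hγ0 : 0 ≤ γ) (hγ1 : γ ≤ 1) :
    ∃ κ A C₅ : ℝ, 0 < κ ∧ 0 ≤ A ∧ 0 ≤ C₅ ∧
      ∀ (n : ℕ) (_hn : 1 ≤ n) (M : ℕ → Fin d → ℕ) [∀ j μ, NeZero (M j μ)]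
        (_hM : ∀ j, ∃ mm : ℕ, ∀ μ, L * M j μ = 2 * L ^ mm)
        (C : Carriers) (_hsc : ∀ X, 1 ≤ C.scale X)
        (xA yA : (X : C.Dom) → Tor (fine (L ^ C.scale X) (fine L (M (C.scale X)))))
        (xB yB : (X : C.Dom) → Tor (fine (L ^ n * L ^ C.scale X) (fine L (M (C.scale X)))))
        (_hx : ∀ X μ, (xA X μ).val = (xB X μ).val / L ^ n)
        (_hy : ∀ X μ, (yA X μ).val = (yB X μ).val / L ^ n)
        (_hd : ∀ X, C.d X ≤ tdistT (fine L (M (C.scale X)))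
            (blockOf (L ^ C.scale X) (fine L (M (C.scale X))) (xA X))
            (blockOf (L ^ C.scale X) (fine L (M (C.scale X))) (yA X)))
        (h k : (X : C.Dom) → (ℕ → ℝ) → C.BgA → Tor (fine L (M (C.scale X))) → ℝ)
        (_hh : ∀ X g U z, |h X g U z| ≤ 1) (_hk : ∀ X g U w, |k X g U w| ≤ 1)
        (EA : Functional C C.BgA) (EB : Functional C C.BgB)
        (_hEA : ∀ g U X, EA g U X =
          (fun z => minimiser (L ^ C.scale X) (fine L (M (C.scale X))) (aK a L (C.scale X))
              (((L ^ C.scale X : ℕ) : ℝ) ^ 2) m2 (Pi.single z 1) (xA X) * h X g U z)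
            ⬝ᵥ ((effLaplacian (L ^ C.scale X) (fine L (M (C.scale X))) (aK a L (C.scale X))
                    (((L ^ C.scale X : ℕ) : ℝ) ^ 2) m2
                  + (a * ((L : ℝ) ^ 2)⁻¹) • blockProj L (M (C.scale X)))⁻¹
                *ᵥ fun w => k X g U w * minimiser (L ^ C.scale X) (fine L (M (C.scale X))) (aK a L (C.scale X))
                    (((L ^ C.scale X : ℕ) : ℝ) ^ 2) m2 (Pi.single w 1) (yA X)))
        (_hEB : ∀ g U X, EB g U X =
          (fun z => minimiser (L ^ n * L ^ C.scale X) (fine L (M (C.scale X))) (aK a L (C.scale X + n))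
              (((L ^ n * L ^ C.scale X : ℕ) : ℝ) ^ 2) m2 (Pi.single z 1) (xB X) * h X g (C.transport U) z)
            ⬝ᵥ ((effLaplacian (L ^ n * L ^ C.scale X) (fine L (M (C.scale X))) (aK a L (C.scale X + n))
                    (((L ^ n * L ^ C.scale X : ℕ) : ℝ) ^ 2) m2
                  + (a * ((L : ℝ) ^ 2)⁻¹) • blockProj L (M (C.scale X)))⁻¹
                *ᵥ fun w => k X g (C.transport U) w * minimiser (L ^ n * L ^ C.scale X) (fine L (M (C.scale X)))
                    (aK a L (C.scale X + n)) (((L ^ n * L ^ C.scale X : ℕ) : ℝ) ^ 2) m2 (Pi.single w 1) (yB X)))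
        (W : Set (ℕ → ℝ)),
        ∀ {ℓ : ℝ} (_hℓ : 0 ≤ ℓ)
        (_hhℓ : ∀ X g (U U' : C.BgA) z, |h X g U z - h X g U' z| ≤ ℓ * C.gauge U U')
        (_hkℓ : ∀ X g (U U' : C.BgA) w, |k X g U w - k X g U' w| ≤ ℓ * C.gauge U U')
        {Λ : ℕ → ℕ → ℝ} {C₉ ω : ℝ} (_hΛ0 : ∀ j i, 0 ≤ Λ j i) (_hΛ : FadingMemory C₉ ω Λ)
        (_hhΛ : ∀ X, ∀ g ∈ W, ∀ g' ∈ W, ∀ (U : C.BgA) z,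
          |h X g U z - h X g' U z| ≤ ∑ i ∈ Finset.range (C.scale X), Λ (C.scale X) i * |g i - g' i|)
        (_hkΛ : ∀ X, ∀ g ∈ W, ∀ g' ∈ W, ∀ (U : C.BgA) w,
          |k X g U w - k X g' U w| ≤ ∑ i ∈ Finset.range (C.scale X), Λ (C.scale X) i * |g i - g' i|)
        (γ' cr ρ : ℝ),
        N18At ⟨C, W, γ', κ, EA, fun _ => EB, (L : ℝ) ^ (-(γ / 2)), C₅, fun j i => 2 * Λ j i * A, 2 * C₉ * A, ω, cr, ρ⟩ ∧
        N22At ⟨C, W, γ', κ, EA, fun _ => EB, (L : ℝ) ^ (-(γ / 2)), C₅, fun j i => 2 * Λ j i * A, 2 * C₉ * A, ω, cr, ρ⟩ ∧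
        LipBackground EA W κ (fun _ _ => 2 * ℓ * A) ∧
        (∀ (gT : ℕ → ℕ → ℝ) (q : ℕ), PolyLipGrowth (fun _ _ => 2 * ℓ * A) gT (2 * ℓ * A) q) ∧
        (∀ {gA gB : ℕ → ℝ}, gA ∈ W → gB ∈ W → ∀ (UA : C.BgA) (UB : C.BgB) {δ : ℝ},
          C.gauge UA (C.transport UB) ≤ δ → ∀ X : C.Dom,
          |EA gA UA X - EB gB UB X| ≤
            (2 * ℓ * A * δ + (∑ i ∈ Finset.range (C.scale X), 2 * Λ (C.scale X) i * A * |gA i - gB i|)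
              + C₅ * ((L : ℝ) ^ (-(γ / 2))) ^ C.scale X) * Real.exp (-(κ * C.d X))) := by
  obtain ⟨κ, A, C₅, hκ, hA, hC₅, H⟩ := kingModel_vertex_allShapes_torus hd L hLp ha hm hγ0 hγ1
  refine ⟨κ, A, C₅, hκ, hA, hC₅, ?_⟩
  intro n hn M _ hM C hsc xA yA xB yB hx hy hdd h k hh hk EA EB hEA hEB W ℓ hℓ hhℓ hkℓ Λ C₉ ω hΛ0 hΛ hhΛ hkΛ γ' cr ρ
  obtain ⟨_, _, h5, hLip, hHist⟩ := H n hn M hM C hsc xA yA xB yB hx hy hdd h k hh hk EA EB hEA hEB W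
  have hU : LipBackground EA W κ (fun _ _ => 2 * ℓ * A) := hLip ℓ hℓ hhℓ hkℓ
  have h9 : NE9 EA W κ (fun j i => 2 * Λ j i * A) := hHist Λ hΛ0 hhΛ hkΛ
  have hfade : FadingMemory (2 * C₉ * A) ω (fun j i => 2 * Λ j i * A) := by
    intro j i hij
    obtain ⟨h0, h1⟩ := hΛ j i hij
    refine ⟨by positivity, ?_⟩
    calc 2 * Λ j i * A ≤ 2 * (C₉ * ω ^ (j - i)) * A :=
          mul_le_mul_of_nonneg_right (mul_le_mul_of_nonneg_left h1 zero_le_two) hA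
      _ = 2 * C₉ * A * ω ^ (j - i) := by ring
  have hℓA : 0 ≤ 2 * ℓ * A := by positivity
  refine ⟨n18At_of_ne5 h5 γ' _ _ ω cr ρ, ⟨h9, hfade⟩, hU, fun gT q K j _ => ⟨hℓA, ?_⟩, ?_⟩
  · exact le_mul_of_one_le_right hℓA (one_le_pow₀ (by simp))
  · intro gA gB hgA hgB UA UB δ hδ X
    exact u3_threeBrackets h9 hU h5 hgA hgB hδ X hℓA

/-! ## §2 The DRESSED bundle of record: uniformity in the source is automatic in the model -/

/-- **`N18At` ON THE DRESSED U3 BUNDLE IN THE VERTEX MODEL.**  The carriers of record include observable-attached (dressed)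
domains `Dom ⊕ Dom × T` and `N18At` there = vacuum `N18At` ∧ dressed `N18At` UNIFORMLY in the source `t`
(`N18AtByName.n18At_dressed_iff`; `U3Carriers` docstring: «`C₅` UNIFORM in `t` … a prover's burden inside N18»).  In the vertex
model the dressed pieces are King's graphs with a `t`-INDEXED family of vertex functions `h_t, k_t` (bounded by one), and
uniformity in `t` is AUTOMATIC: 6b's letters `κ, C₅` depend on `(d, L, a, m², γ)` only, not on the insertion.  So for every
source type `T`, vacuum insertions `h, k` and dressed families `h_t, k_t`:
`N18At ⟨{C with Dom := Dom ⊕ Dom × T, …}, W, γ′, κ, Sum.elim E_A D_A, Sum.elim E_B D_B, L^{−γ∕2}, C₅, Λ, C₉, ω, cr, ρ⟩`.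
[cite: Balaban1988Convergent, (2.27) p.259; King1986, Prop. 3.9 (3.73) p.665] -/
theorem n18At_dressed_kingModel_vertex_torus (hd : 1 ≤ d) (L : ℕ) [NeZero L] (hLp : Odd L ∧ 1 < L) {a m2 : ℝ}
    (ha : 0 < a) (hm : 0 < m2) {γ : ℝ} (hγ0 : 0 ≤ γ) (hγ1 : γ ≤ 1) :
    ∃ κ C₅ : ℝ, 0 < κ ∧ 0 ≤ C₅ ∧
      ∀ (n : ℕ) (_hn : 1 ≤ n) (M : ℕ → Fin d → ℕ) [∀ j μ, NeZero (M j μ)]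
        (_hM : ∀ j, ∃ mm : ℕ, ∀ μ, L * M j μ = 2 * L ^ mm)
        (C : Carriers) (_hsc : ∀ X, 1 ≤ C.scale X)
        (xA yA : (X : C.Dom) → Tor (fine (L ^ C.scale X) (fine L (M (C.scale X)))))
        (xB yB : (X : C.Dom) → Tor (fine (L ^ n * L ^ C.scale X) (fine L (M (C.scale X)))))
        (_hx : ∀ X μ, (xA X μ).val = (xB X μ).val / L ^ n)
        (_hy : ∀ X μ, (yA X μ).val = (yB X μ).val / L ^ n)
        (_hd : ∀ X, C.d X ≤ tdistT (fine L (M (C.scale X)))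
            (blockOf (L ^ C.scale X) (fine L (M (C.scale X))) (xA X))
            (blockOf (L ^ C.scale X) (fine L (M (C.scale X))) (yA X)))
        {T : Type}
        (h k : (X : C.Dom) → (ℕ → ℝ) → C.BgA → Tor (fine L (M (C.scale X))) → ℝ)
        (hT kT : T → (X : C.Dom) → (ℕ → ℝ) → C.BgA → Tor (fine L (M (C.scale X))) → ℝ)
        (_hh : ∀ X g U z, |h X g U z| ≤ 1) (_hk : ∀ X g U w, |k X g U w| ≤ 1)
        (_hhT : ∀ t X g U z, |hT t X g U z| ≤ 1) (_hkT : ∀ t X g U w, |kT t X g U w| ≤ 1)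
        (EA : Functional C C.BgA) (EB : Functional C C.BgB) (DA : T → Functional C C.BgA) (DB : T → Functional C C.BgB)
        (_hEA : ∀ g U X, EA g U X =
          (fun z => minimiser (L ^ C.scale X) (fine L (M (C.scale X))) (aK a L (C.scale X))
              (((L ^ C.scale X : ℕ) : ℝ) ^ 2) m2 (Pi.single z 1) (xA X) * h X g U z)
            ⬝ᵥ ((effLaplacian (L ^ C.scale X) (fine L (M (C.scale X))) (aK a L (C.scale X))
                    (((L ^ C.scale X : ℕ) : ℝ) ^ 2) m2
                  + (a * ((L : ℝ) ^ 2)⁻¹) • blockProj L (M (C.scale X)))⁻¹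
                *ᵥ fun w => k X g U w * minimiser (L ^ C.scale X) (fine L (M (C.scale X))) (aK a L (C.scale X))
                    (((L ^ C.scale X : ℕ) : ℝ) ^ 2) m2 (Pi.single w 1) (yA X)))
        (_hEB : ∀ g U X, EB g U X =
          (fun z => minimiser (L ^ n * L ^ C.scale X) (fine L (M (C.scale X))) (aK a L (C.scale X + n))
              (((L ^ n * L ^ C.scale X : ℕ) : ℝ) ^ 2) m2 (Pi.single z 1) (xB X) * h X g (C.transport U) z)
            ⬝ᵥ ((effLaplacian (L ^ n * L ^ C.scale X) (fine L (M (C.scale X))) (aK a L (C.scale X + n))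
                    (((L ^ n * L ^ C.scale X : ℕ) : ℝ) ^ 2) m2
                  + (a * ((L : ℝ) ^ 2)⁻¹) • blockProj L (M (C.scale X)))⁻¹
                *ᵥ fun w => k X g (C.transport U) w * minimiser (L ^ n * L ^ C.scale X) (fine L (M (C.scale X)))
                    (aK a L (C.scale X + n)) (((L ^ n * L ^ C.scale X : ℕ) : ℝ) ^ 2) m2 (Pi.single w 1) (yB X)))
        (_hDA : ∀ t g U X, DA t g U X =
          (fun z => minimiser (L ^ C.scale X) (fine L (M (C.scale X))) (aK a L (C.scale X))
              (((L ^ C.scale X : ℕ) : ℝ) ^ 2) m2 (Pi.single z 1) (xA X) * hT t X g U z)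
            ⬝ᵥ ((effLaplacian (L ^ C.scale X) (fine L (M (C.scale X))) (aK a L (C.scale X))
                    (((L ^ C.scale X : ℕ) : ℝ) ^ 2) m2
                  + (a * ((L : ℝ) ^ 2)⁻¹) • blockProj L (M (C.scale X)))⁻¹
                *ᵥ fun w => kT t X g U w * minimiser (L ^ C.scale X) (fine L (M (C.scale X))) (aK a L (C.scale X))
                    (((L ^ C.scale X : ℕ) : ℝ) ^ 2) m2 (Pi.single w 1) (yA X)))
        (_hDB : ∀ t g U X, DB t g U X =
          (fun z => minimiser (L ^ n * L ^ C.scale X) (fine L (M (C.scale X))) (aK a L (C.scale X + n))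
              (((L ^ n * L ^ C.scale X : ℕ) : ℝ) ^ 2) m2 (Pi.single z 1) (xB X) * hT t X g (C.transport U) z)
            ⬝ᵥ ((effLaplacian (L ^ n * L ^ C.scale X) (fine L (M (C.scale X))) (aK a L (C.scale X + n))
                    (((L ^ n * L ^ C.scale X : ℕ) : ℝ) ^ 2) m2
                  + (a * ((L : ℝ) ^ 2)⁻¹) • blockProj L (M (C.scale X)))⁻¹
                *ᵥ fun w => kT t X g (C.transport U) w * minimiser (L ^ n * L ^ C.scale X) (fine L (M (C.scale X)))
                    (aK a L (C.scale X + n)) (((L ^ n * L ^ C.scale X : ℕ) : ℝ) ^ 2) m2 (Pi.single w 1) (yB X)))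
        (W : Set (ℕ → ℝ)) (γ' : ℝ) (Λ : ℕ → ℕ → ℝ) (C₉ ω cr ρ : ℝ),
        N18At ⟨{ C with
                  Dom := C.Dom ⊕ (C.Dom × T)
                  scale := Sum.elim C.scale fun p => C.scale p.1
                  d := Sum.elim C.d fun p => C.d p.1
                  d_nonneg := Sum.rec (fun X => C.d_nonneg X) fun p => C.d_nonneg p.1 },
                W, γ', κ, (fun g U X => Sum.elim (EA g U) (fun p => DA p.2 g U p.1) X),
                (fun (_ : ℝ) g U X => Sum.elim (EB g U) (fun p => DB p.2 g U p.1) X), (L : ℝ) ^ (-(γ / 2)), C₅,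
                Λ, C₉, ω, cr, ρ⟩ := by
  obtain ⟨κ, A, C₅, hκ, hA, hC₅, H⟩ := kingModel_vertex_allShapes_torus hd L hLp ha hm hγ0 hγ1
  refine ⟨κ, C₅, hκ, hC₅, ?_⟩
  intro n hn M _ hM C hsc xA yA xB yB hx hy hdd T h k hT kT hh hk hhT hkT EA EB DA DB hEA hEB hDA hDB W γ' Λ C₉ ω cr ρ
  have h5 := (H n hn M hM C hsc xA yA xB yB hx hy hdd h k hh hk EA EB hEA hEB W).2.2.1
  have h5T : ∀ t, NE5 (DA t) (DB t) W κ ((L : ℝ) ^ (-(γ / 2))) C₅ := fun t =>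
    (H n hn M hM C hsc xA yA xB yB hx hy hdd (hT t) (kT t) (hhT t) (hkT t) (DA t) (DB t) (hDA t) (hDB t) W).2.2.1
  exact (n18At_dressed_iff EA (fun _ => EB) DA (fun t _ => DB t)).2
    ⟨n18At_of_ne5 h5 γ' Λ C₉ ω cr ρ, fun t => n18At_of_ne5 (h5T t) γ' Λ C₉ ω cr ρ⟩

end Summit.QuantumFields.YangMills.BalabanUVNodes.N18KingModelVertexU3

end
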